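import Summits.BirchSwinnertonDyer.BirchSwinnertonDyer.Theorems.ClassRecordThreeEulerHalvesAtThreeShimuraFamilyProducersLocalTamagawa
import HarnessLib

/-!
# Route `ErratumRoadFive` (K2, `p ≥ 5`), crux `EulerHalfNotRamNoInertSetAtFive` (item stmt-BirchSwinnertonDyer-19715), line `birth` v13:
# the walk's E⁰-RECEPTACLE and the two single-datum producers `hSel` ∕ `hstrq` from GROSS'S E′-LABEL at the split carriers
# — «some prime-to-`p` multiple of `y_m` lies in `E⁰(K[m]_w)`» instead of (B6) «`y_m − t ∈ E⁰(K[m]_w)`, `t ∈ E(ℚ)_tors`»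
# (cell `bsd-stepL`, width seat `bsd-line-er5-p1-w3` g5; `--supports stmt-BirchSwinnertonDyer-19715 --as helper`)

WHY THIS FILE. Line `birth` v13 of crux 19715 carries the structured input LAB (`stub_shimuraCarrierLabelsB6AtFive`) whose only
beyond-print conjunct is the identity-component label `ShimuraCMFamily.LabelB6 ι W N {q} ys` at the split carrier primes `q ∉ S`,
`p ∣ c_q(E)` (RULING 57; PROOF-B6). The ideator bsd-idea-9 g7 (HOME INBOX 2026-08-28T13:03:53Z) observed that the walk never uses (B6)
itself: the generic cores `ShimuraWalk.localization_kolyvaginClass_familyData_mem_stringentFamily` (Jetchev 4.9) and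
`ShimuraWalk.kolyvaginClass_familyData_mem_selmerLocalKer_of_tamagawa` (Gross 6.2 (1)) take an ARBITRARY exponent `n'' : ℤ` coprime
to `p^M` with `n'' • (γ y_m)_v ∈ E0Receptacle (E⁄K) v` — Gross's «replace `E⁰` by `E′` with `(E′ : E⁰)` prime to `p`» (LMS 1991
p. 245) — and only the three wrappers `ShimuraKolyvaginOfImage.receptacle_of_labelB6` ∕ `ShimuraWalk.familyReceptacle_of_labelB6` ∕
`…_of_labelB6_singleton`, `…_of_labelsAt_of_tamagawa` insist on `LabelB6` (`n'' := #E(ℚ)_tors`). THIS FILE re-threads those wrappers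
on the WEAKER per-carrier **E′-label** «`∃ n' : ℕ, ¬ p ∣ n' ∧` at every guarded level `m` and every place `w ∣ q` of `K[m]`,
`n' • ys m ∈ E₀(K[m])_w` (nonsingular reduction on the globally minimal `W`)» — the currency in which an auxiliary-norm argument at a
K-SPLIT carrier can supply it without integral models of `X_{N⁺,N⁻}` (ideator's lemma; not used or asserted here).
* §1 `nsmul_pointsMap_map_mem_E0Receptacle` — transport: `n' • P ∈ E₀(L)_w` at every `w ∋ q` ⟹ `n' • (e P)_v ∈ E0Receptacle (E⁄K) v`.
* §1 `receptacle_of_labelE0Prime` — twin of `receptacle_of_labelB6` (tam3-p1 g12): the `hGZ′`-shaped binder at every place of `K`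
  over `q`, both clauses, every `γ`, every embedding, witness `n'` (no torsion hypothesis, no irreducibility needed).
* §2 `labelE0Prime_of_labelB6_singleton` — COMPATIBILITY: `LabelB6 ι W N {q} ys` + `E[p]` irreducible ⟹ the E′-label at `q` with
  `n' := #E(ℚ)_tors`; so LAB ⟹ LAB′ and nothing of v13 is lost.
* §2 `exists_uniform_exponent_of_carrierLabelsE0Prime` — one exponent for all carriers outside `S` (finite product; bookkeeping).
* §3 `familyReceptacle_of_labelE0Prime` — twin of `familyReceptacle_of_labelB6` (corner3-p2 g8) for a family of data `(d m).y = ys m`.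
* §4 `kolyvaginClass_familyData_mem_selmerLocalKer_of_labelsAt_of_tamagawa_of_E0Prime` (producer `hSel`) and
  `localization_kolyvaginClass_familyData_mem_stringentFamily_of_labelE0Prime_singleton` (producer `hstrq`) — twins of tam3-p1 g15's
  producers with `hB6T` replaced by the per-carrier E′-labels `hE0T`.
HONEST FRAMING: THEOREMS ONLY (no def, no named fact, no `sorry`); labels are HYPOTHESES; nothing closes; 19715 OPEN; BSD proved for no curve (T7).
-- adapted from Summits/…/Theorems/ClassRecordThreeEulerHalvesAtThreeShimuraE0ReceptacleOfLabelB6.lean (§1–§2), …ShimuraFamilyLabels.lean (§3), …ShimuraFamilyProducersLocalTamagawa.lean (§4).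
References (locators only): [cite: GrossLMS1991, §6, proof of Prop. 6.2 (1), p. 245 («E′ with (E′:E⁰) prime to p»)] [cite: GrossZagier1986Heegner, III (3.1)]
[cite: Jetchev2008, Prop. 4.6, Cor. 4.8, Prop. 4.9] [cite: SilvermanAEC2009, VII.2 Prop. 2.1] [cite: MilneADT2006, Ch. I Prop. 3.8].
presearch: n/a (re-threading of tree theorems; the mathematical content «E′» is Gross 1991 p. 245, cited in the tree at `LabelB6.exists_nsmul`).
-/

set_option autoImplicit false
set_option linter.dupNamespace false -- `Summit.BirchSwinnertonDyer.BirchSwinnertonDyer` (summit = problem), tree-wide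

noncomputable section
open scoped Classical NumberField Pointwise

namespace Summit.BirchSwinnertonDyer.BirchSwinnertonDyer.Theorems.ShimuraKolyvaginOfImage

open WeierstrassCurve IsDedekindDomain NumberField Field Literature.NumberTheory.EllipticCurves
  Literature.NumberTheory.EllipticCurves.ModularForms
  Literature.NumberTheory.GaloisRepresentations
  Summit.BirchSwinnertonDyer.Rank1Residual.X11b Literature.NumberTheory.Automorphic
  Summit.BirchSwinnertonDyer.Rank1Residual.JET
  Literature.NumberTheory.EllipticCurves.ShimuraCMFamily

/-! ### §1 The receptacle from the E′-label -/

/-- **`n' • (e P)_v ∈ E⁰(K̄_v)` when `n' • P ∈ E₀(L)_w` at every place `w` of `L` above `q ∈ v`.** For `W/ℚ` globally minimal, a finite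
place `v` of the number field `K` with `(W⁄K) ⊗ K_v` minimal and a prime `q ∈ v`, a number field `L` with a `ℚ`-embedding `e : L → K̄`,
a point `P ∈ E(L)` and an exponent `n'` such that `n' • P` has nonsingular reduction (on `W`) at every place `w` of `L` containing `q`:
the image of `n' • P` in `E(K̄_v)` lies in the receptacle (JET's transport `pointsMap_map_mem_E0Receptacle_of_forall_place`).
[cite: SilvermanAEC2009, VII.2 Prop. 2.1, VII.1 Prop. 1.3 (b)] [cite: GrossLMS1991, §6, proof of Prop. 6.2 (1), p. 245] -/
theorem nsmul_pointsMap_map_mem_E0Receptacle (W : WeierstrassCurve ℚ) [W.IsElliptic]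
    [W.IsGloballyMinimal] {K : Type} [Field K] [NumberField K] (v : HeightOneSpectrum (𝓞 K))
    (hmin : ((W.baseChange K).baseChange (v.adicCompletion K)).IsMinimal (v.adicCompletionIntegers K))
    (q : ℕ) (hqv : ((q : ℕ) : 𝓞 K) ∈ v.asIdeal) {L : Type} [Field L] [NumberField L] [DecidableEq L]
    (e : L →ₐ[ℚ] AlgebraicClosure K) (P : (W.baseChange L).toAffine.Point) (n' : ℕ)
    (hP : ∀ w : HeightOneSpectrum (𝓞 L), ((q : ℕ) : 𝓞 L) ∈ w.asIdeal →
      (placeIntModel W L w).HasNonsingularReduction (K := L) (n' • P)) :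
    (n' : ℤ) • pointsMap (W.baseChange K) (v.adicCompletion K) (Affine.Point.map (W' := W) e P) ∈
      E0Receptacle (W.baseChange K) v := by
  have key := pointsMap_map_mem_E0Receptacle_of_forall_place W v hmin hqv e (n' • P) hP
  have h1 : Affine.Point.map (W' := W) e (n' • P) = n' • Affine.Point.map (W' := W) e P :=
    map_nsmul _ _ _
  have h2 : pointsMap (W.baseChange K) (v.adicCompletion K) (n' • Affine.Point.map (W' := W) e P) =
      n' • pointsMap (W.baseChange K) (v.adicCompletion K) (Affine.Point.map (W' := W) e P) :=
    map_nsmul _ _ _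
  rw [h1, h2] at key
  rw [natCast_zsmul]
  exact key

/-- **The walk's receptacle input from the E′-LABEL at a split prime, for a BARE family on `X_{N⁺,N⁻}`.** `W/ℚ` globally minimal,
`K` imaginary quadratic, `ι : K → ℂ`, `K[m] = ringClassField K ι m`, a family `ys m ∈ E(K[m])`, a prime `q ∣ N` that SPLITS in `K`,
and the E′-label at `q` with exponent `n'` prime to `p` (guarded as printed: square-free `m` with prime factors `∤ N` and inert in `K`;
at every place `w` of `K[m]` above `q`, `n' • ys m ∈ E₀(K[m])_w`). THEN `IsCoprime p n'` and, for every such `m`, every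
`ℚ`-embedding `e : K[m] → K̄`, every `γ ∈ Aut_ℚ(K[m])` and every place `v` of `K` above `q`: `n' • (e (γ • ys m))_v ∈ E0Receptacle (W⁄K) v`,
and the same for `ys m'` at every labelled level `m'` with `K[m'] ≤ K[m]`, read in `K[m]`. Twin of `receptacle_of_labelB6` with Gross's
`E′` in place of `E⁰` up to rational torsion; CONDITIONAL on the label; nothing is asserted about any CM point.
[cite: GrossLMS1991, §6, proof of Prop. 6.2 (1), p. 245] [cite: GrossZagier1986Heegner, III (3.1)] -/
theorem receptacle_of_labelE0Prime (W : WeierstrassCurve ℚ) [W.IsElliptic] [W.IsGloballyMinimal]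
    {K : Type} [Field K] [NumberField K] (hK : IsImaginaryQuadratic K) (ι : K →+* ℂ)
    (p : ℕ) [Fact p.Prime]
    {N : ℕ} (q : ℕ) [Fact q.Prime] (hqN : q ∣ N) (hq2 : ((Ideal.span {(q : ℤ)}).primesOver (𝓞 K)).ncard = 2)
    [∀ j : ℕ, NumberField (ringClassField K ι j)]
    (ys : (m : ℕ) → (W.baseChange (ringClassField K ι m)).toAffine.Point) {n' : ℕ} (hpn' : ¬ p ∣ n')
    (hE0 : ∀ m : ℕ, Squarefree m → (∀ r ∈ m.primeFactors, ¬ r ∣ N ∧ (Ideal.span {(r : 𝓞 K)}).IsPrime) →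
      ∀ w : HeightOneSpectrum (𝓞 (ringClassField K ι m)), ((q : ℕ) : 𝓞 (ringClassField K ι m)) ∈ w.asIdeal →
        (placeIntModel W (ringClassField K ι m) w).HasNonsingularReduction (K := ringClassField K ι m) (n' • ys m)) :
    IsCoprime (p : ℤ) (n' : ℤ) ∧
      ∀ (m : ℕ), Squarefree m → (∀ r ∈ m.primeFactors, ¬ r ∣ N ∧ (Ideal.span {(r : 𝓞 K)}).IsPrime) →
        ∀ (e : ringClassField K ι m →ₐ[ℚ] AlgebraicClosure K)
          (γ : ringClassField K ι m ≃ₐ[ℚ] ringClassField K ι m)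
          (v : HeightOneSpectrum (𝓞 K)), ((q : ℕ) : 𝓞 K) ∈ v.asIdeal →
          (n' : ℤ) • pointsMap (W.baseChange K) (v.adicCompletion K)
              (Affine.Point.map (W' := W) e (pointGalHom W (ringClassField K ι m) γ (ys m))) ∈
            E0Receptacle (W.baseChange K) v ∧
          ∀ (m' : ℕ), Squarefree m' → (∀ r ∈ m'.primeFactors, ¬ r ∣ N ∧ (Ideal.span {(r : 𝓞 K)}).IsPrime) →
            ∀ (hle : ringClassField K ι m' ≤ ringClassField K ι m),
            (n' : ℤ) • pointsMap (W.baseChange K) (v.adicCompletion K)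
                (Affine.Point.map (W' := W) e (pointGalHom W (ringClassField K ι m) γ
                  (WeierstrassCurve.Affine.Point.map (W' := W)
                    ((RingClassField.inclusion ι hle).restrictScalars ℚ) (ys m')))) ∈
              E0Receptacle (W.baseChange K) v := by
  have hp : p.Prime := Fact.out
  refine ⟨Nat.isCoprime_iff_coprime.mpr ((Nat.Prime.coprime_iff_not_dvd hp).mpr hpn'), ?_⟩
  intro m hm hguard e γ v hqv
  obtain ⟨-, hmin⟩ := natCast_mem_and_isMinimal_of_split W hK q hq2 hqN v hqv
  refine ⟨?_, fun m' hm' hguard' hle ↦ ?_⟩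
  · -- level `m`
    rw [pointGalHom_apply]
    change (n' : ℤ) • pointsMap (W.baseChange K) (v.adicCompletion K)
      (Affine.Point.map (W' := W) e
        (Affine.Point.map (W' := W) (γ : ringClassField K ι m →ₐ[ℚ] ringClassField K ι m) (ys m))) ∈ _
    rw [Affine.Point.map_map]
    exact nsmul_pointsMap_map_mem_E0Receptacle W v hmin q hqv _ (ys m) n' (hE0 m hm hguard)
  · -- level `m'` read in `K[m]`
    rw [pointGalHom_apply]
    change (n' : ℤ) • pointsMap (W.baseChange K) (v.adicCompletion K)
      (Affine.Point.map (W' := W) e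
        (Affine.Point.map (W' := W) (γ : ringClassField K ι m →ₐ[ℚ] ringClassField K ι m)
          (Affine.Point.map (W' := W) ((RingClassField.inclusion ι hle).restrictScalars ℚ) (ys m')))) ∈ _
    rw [Affine.Point.map_map, Affine.Point.map_map]
    exact nsmul_pointsMap_map_mem_E0Receptacle W v hmin q hqv _ (ys m') n' (hE0 m' hm' hguard')

/-! ### §2 Compatibility with (B6), and one exponent for all carriers -/

/-- **(B6) at `q` ⟹ the E′-label at `q` with exponent `#E(ℚ)_tors`, for irreducible `E[p]`.** If `ys m − t ∈ E₀(K[m])_w` with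
`t ∈ E(ℚ)` torsion then `#E(ℚ)_tors • ys m = #E(ℚ)_tors • (ys m − t) ∈ E₀(K[m])_w` (`E₀ ∩ E(L)` is a group, Silverman VII.2.1), and
`p ∤ #E(ℚ)_tors` (`isCoprime_torsionOrder_of_irr`). So LAB (v10–v13) implies LAB′: nothing of the line is lost by the re-threading.
[cite: GrossLMS1991, §6, proof of Prop. 6.2 (1), p. 245] [cite: SilvermanAEC2009, VII.2 Prop. 2.1] -/
theorem labelE0Prime_of_labelB6_singleton (W : WeierstrassCurve ℚ) [W.IsElliptic] [W.IsGloballyMinimal]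
    {K : Type} [Field K] [NumberField K] (ι : K →+* ℂ) (p : ℕ) [Fact p.Prime] (hirr : W.HasIrreducibleModPGaloisRep p)
    {N : ℕ} (q : ℕ) (ys : (m : ℕ) → (W.baseChange (ringClassField K ι m)).toAffine.Point)
    (hB6 : LabelB6 ι W N {q} ys) :
    ∃ n' : ℕ, ¬ p ∣ n' ∧ ∀ m : ℕ, Squarefree m → (∀ r ∈ m.primeFactors, ¬ r ∣ N ∧ (Ideal.span {(r : 𝓞 K)}).IsPrime) →
      ∀ [NumberField (ringClassField K ι m)] (w : HeightOneSpectrum (𝓞 (ringClassField K ι m))),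
        ((q : ℕ) : 𝓞 (ringClassField K ι m)) ∈ w.asIdeal →
        (placeIntModel W (ringClassField K ι m) w).HasNonsingularReduction (K := ringClassField K ι m)
          (n' • ys m) := by
  have hcop : ¬ p ∣ W.torsionOrder := fun h ↦ not_hasIrreducibleModPGaloisRep_of_dvd_torsionOrder W p h hirr
  refine ⟨W.torsionOrder, hcop, fun m hm hguard _ w hw ↦ ?_⟩
  obtain ⟨t, ht, hmem⟩ := hB6.at (Finset.mem_singleton_self q) m hm hguard w hw
  have htors : W.torsionOrder • t = 0 :=
    addOrderOf_dvd_iff_nsmul_eq_zero.mp (addOrderOf_dvd_torsionOrder W ht)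
  have hpt : W.pointToBaseChange (ringClassField K ι m) (W.torsionOrder • t) =
      W.torsionOrder • W.pointToBaseChange (ringClassField K ι m) t := by
    rw [pointToBaseChange_eq_map, pointToBaseChange_eq_map]
    exact map_nsmul (Affine.Point.map (W' := W) (F := ℚ) (Algebra.ofId ℚ (ringClassField K ι m))) W.torsionOrder t
  have h0 : W.pointToBaseChange (ringClassField K ι m) 0 = 0 := by
    rw [pointToBaseChange_eq_map]
    exact map_zero _
  have heq : W.torsionOrder • (ys m - W.pointToBaseChange (ringClassField K ι m) t) = W.torsionOrder • ys m := by
    rw [nsmul_sub, ← hpt, htors, h0, sub_zero]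
  have key := Gross1991_heegnerPoint_sub_ratTorsion_mem_E0.hasNonsingularReduction_placeIntModel_nsmul
    (ringClassField K ι m) w hmem W.torsionOrder
  rw [heq] at key
  exact key

/-- **One exponent for all carriers outside `S`.** From per-carrier E′-labels («for each prime `q ∣ N`, `q ∉ S` with
`p ∣ c_q(E/ℚ_q)`: some `n'_q` prime to `p` with `n'_q • ys m ∈ E₀(K[m])_w` at every `w ∋ q`») to a SINGLE exponent `n'` prime to `p`
serving every carrier (the product over the prime factors of `N`; `E₀ ∩ E(L)` is closed under multiples). Bookkeeping for the Kummer
producer of §4, whose generic core takes one exponent. [cite: GrossLMS1991, §6, proof of Prop. 6.2 (1), p. 245] [cite: SilvermanAEC2009, VII.2 Prop. 2.1] -/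
theorem exists_uniform_exponent_of_carrierLabelsE0Prime (W : WeierstrassCurve ℚ) [W.IsElliptic] [W.IsGloballyMinimal]
    {K : Type} [Field K] [NumberField K] (ι : K →+* ℂ) (p : ℕ) [Fact p.Prime]
    {N : ℕ} [NeZero N] (S : Finset ℕ) (ys : (m : ℕ) → (W.baseChange (ringClassField K ι m)).toAffine.Point)
    (hE0T : ∀ (q : ℕ) [Fact q.Prime], q ∣ N → q ∉ S → p ∣ (W.baseChange ℚ_[q]).localTamagawaNumber ℤ_[q] →
      ∃ n' : ℕ, ¬ p ∣ n' ∧ ∀ m : ℕ, Squarefree m → (∀ r ∈ m.primeFactors, ¬ r ∣ N ∧ (Ideal.span {(r : 𝓞 K)}).IsPrime) →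
        ∀ [NumberField (ringClassField K ι m)] (w : HeightOneSpectrum (𝓞 (ringClassField K ι m))),
          ((q : ℕ) : 𝓞 (ringClassField K ι m)) ∈ w.asIdeal →
          (placeIntModel W (ringClassField K ι m) w).HasNonsingularReduction (K := ringClassField K ι m) (n' • ys m)) :
    ∃ n' : ℕ, ¬ p ∣ n' ∧ ∀ (q : ℕ) [Fact q.Prime], q ∣ N → q ∉ S → p ∣ (W.baseChange ℚ_[q]).localTamagawaNumber ℤ_[q] →
      ∀ m : ℕ, Squarefree m → (∀ r ∈ m.primeFactors, ¬ r ∣ N ∧ (Ideal.span {(r : 𝓞 K)}).IsPrime) →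
        ∀ [NumberField (ringClassField K ι m)] (w : HeightOneSpectrum (𝓞 (ringClassField K ι m))),
          ((q : ℕ) : 𝓞 (ringClassField K ι m)) ∈ w.asIdeal →
          (placeIntModel W (ringClassField K ι m) w).HasNonsingularReduction (K := ringClassField K ι m) (n' • ys m) := by
  have hp : p.Prime := Fact.out
  have hN0 : N ≠ 0 := NeZero.ne N
  -- per-prime exponent, `1` off the carriers
  have hex : ∀ q ∈ N.primeFactors, ∃ nq : ℕ, ¬ p ∣ nq ∧ ∀ (hq : Fact q.Prime), q ∉ S →
      p ∣ (W.baseChange ℚ_[q]).localTamagawaNumber ℤ_[q] →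
      ∀ m : ℕ, Squarefree m → (∀ r ∈ m.primeFactors, ¬ r ∣ N ∧ (Ideal.span {(r : 𝓞 K)}).IsPrime) →
        ∀ [NumberField (ringClassField K ι m)] (w : HeightOneSpectrum (𝓞 (ringClassField K ι m))),
          ((q : ℕ) : 𝓞 (ringClassField K ι m)) ∈ w.asIdeal →
          (placeIntModel W (ringClassField K ι m) w).HasNonsingularReduction (K := ringClassField K ι m) (nq • ys m) := by
    intro q hq
    haveI hqF : Fact q.Prime := ⟨Nat.prime_of_mem_primeFactors hq⟩
    by_cases hc : q ∉ S ∧ p ∣ (W.baseChange ℚ_[q]).localTamagawaNumber ℤ_[q]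
    · obtain ⟨nq, hpnq, hnq⟩ := hE0T q (Nat.dvd_of_mem_primeFactors hq) hc.1 hc.2
      exact ⟨nq, hpnq, fun _ _ _ ↦ hnq⟩
    · exact ⟨1, fun h ↦ hp.one_lt.ne' (Nat.dvd_one.mp h), fun _ hqS hcq ↦ (hc ⟨hqS, hcq⟩).elim⟩
  choose! nq hpnq hnq using hex
  refine ⟨∏ q ∈ N.primeFactors, nq q, fun hdvd ↦ ?_, fun q _ hqN hqS hcq m hm hg _ w hw ↦ ?_⟩
  · obtain ⟨q, hq, hpq⟩ := (Nat.Prime.prime hp).exists_mem_finset_dvd hdvd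
    exact hpnq q hq hpq
  · have hq : q ∈ N.primeFactors := Nat.mem_primeFactors.mpr ⟨Fact.out, hqN, hN0⟩
    obtain ⟨k, hk⟩ := Finset.dvd_prod_of_mem nq hq
    rw [hk, mul_nsmul]
    exact Gross1991_heegnerPoint_sub_ratTorsion_mem_E0.hasNonsingularReduction_placeIntModel_nsmul _ w
      (hnq q hq _ hqS hcq m hm hg w hw) k

end Summit.BirchSwinnertonDyer.BirchSwinnertonDyer.Theorems.ShimuraKolyvaginOfImage

/-! ### §3 The family receptacle from the E′-label -/

namespace Summit.BirchSwinnertonDyer.BirchSwinnertonDyer.Theorems.ShimuraWalk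

open WeierstrassCurve Field NumberField IsDedekindDomain Finset
  Literature.NumberTheory.EllipticCurves Literature.NumberTheory.GaloisRepresentations
  Literature.NumberTheory.EllipticCurves.KolyvaginCocycle
  Literature.NumberTheory.EllipticCurves.RingClassField
  Literature.NumberTheory.EllipticCurves.ModularForms
  Summit.BirchSwinnertonDyer.Rank1Residual.X11b
  Summit.BirchSwinnertonDyer.Rank1Residual.JET
  Summit.BirchSwinnertonDyer.BirchSwinnertonDyer.Theorems
  Literature.NumberTheory.EllipticCurves.ShimuraCMFamily Literature.NumberTheory.Automorphic

variable {K : Type} [Field K] [NumberField K] {W : WeierstrassCurve ℚ} {ι : K →+* ℂ}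

/-- **The E⁰-receptacle over a split bad prime from the E′-LABEL, in the shape the family bricks consume**: for `q` prime with `q ∣ N` and
two primes of `K` above it, an exponent `n'` prime to `p`, and at every `m ∣ n`, every `γ`, every `v ∋ q`:
`n' • ((d m).toGeomPoints (γ • y(m)))_v ∈ E⁰(K̄_v)` and the same for the `y(m∕ℓ)↑` — §1's `receptacle_of_labelE0Prime` on a family of data
with `(d m).y = ys m`. Twin of `familyReceptacle_of_labelB6`. [cite: GrossLMS1991, §6 proof of Prop. 6.2 (1), p. 245] -/
theorem familyReceptacle_of_labelE0Prime {N : ℕ} [W.IsElliptic] [W.IsGloballyMinimal] (hK : IsImaginaryQuadratic K) (ι : K →+* ℂ)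
    (p : ℕ) [Fact p.Prime] [∀ j : ℕ, NumberField (ringClassField K ι j)]
    {n : ℕ} (hn : Squarefree n) (hguard : ∀ q ∈ n.primeFactors, ¬ q ∣ N ∧ (Ideal.span {(q : 𝓞 K)}).IsPrime)
    (ys : (m : ℕ) → (W.baseChange (ringClassField K ι m)).toAffine.Point)
    {q : ℕ} (hqp : q.Prime) (hqN : q ∣ N) (hq2 : ((Ideal.span {(q : ℤ)}).primesOver (𝓞 K)).ncard = 2)
    {n' : ℕ} (hpn' : ¬ p ∣ n')
    (hE0 : ∀ m : ℕ, Squarefree m → (∀ r ∈ m.primeFactors, ¬ r ∣ N ∧ (Ideal.span {(r : 𝓞 K)}).IsPrime) →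
      ∀ w : HeightOneSpectrum (𝓞 (ringClassField K ι m)), ((q : ℕ) : 𝓞 (ringClassField K ι m)) ∈ w.asIdeal →
        (placeIntModel W (ringClassField K ι m) w).HasNonsingularReduction (K := ringClassField K ι m) (n' • ys m))
    (d : (m : ℕ) → m ∣ n → KolyvaginFamilyData W K ι m) (hy : ∀ (m : ℕ) (hm : m ∣ n), (d m hm).y = ys m) :
    IsCoprime (p : ℤ) (n' : ℤ) ∧
      ∀ (m : ℕ) (hm : m ∣ n) (γ : ringClassField K ι m ≃ₐ[ℚ] ringClassField K ι m) (v : HeightOneSpectrum (𝓞 K)),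
      ((q : ℕ) : 𝓞 K) ∈ v.asIdeal →
        (n' : ℤ) • pointsMap (W.baseChange K) (v.adicCompletion K)
            ((d m hm).toGeomPoints (pointGalHom W (ringClassField K ι m) γ (d m hm).y)) ∈
          E0Receptacle (W.baseChange K) v ∧
        ∀ (ℓ : ℕ) (hℓ : ℓ ∈ m.primeFactors)
          (hle : ringClassField K ι (m / ℓ) ≤ ringClassField K ι m),
          (n' : ℤ) • pointsMap (W.baseChange K) (v.adicCompletion K)
              ((d m hm).toGeomPoints (pointGalHom W (ringClassField K ι m) γ
                (WeierstrassCurve.Affine.Point.map (W' := W)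
                  ((RingClassField.inclusion ι hle).restrictScalars ℚ)
                  (d (m / ℓ) ((Nat.div_dvd_of_dvd (Nat.dvd_of_mem_primeFactors hℓ)).trans hm)).y))) ∈
            E0Receptacle (W.baseChange K) v := by
  haveI : Fact q.Prime := ⟨hqp⟩
  have hn0 : n ≠ 0 := hn.ne_zero
  have hg : ∀ (m : ℕ), m ∣ n → ∀ q ∈ m.primeFactors, ¬ q ∣ N ∧ (Ideal.span {(q : 𝓞 K)}).IsPrime :=
    fun m hm q hq ↦ hguard q (Nat.primeFactors_mono hm hn0 hq)
  obtain ⟨hcop, hrec⟩ := ShimuraKolyvaginOfImage.receptacle_of_labelE0Prime W hK ι p q hqN hq2 ys hpn' hE0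
  refine ⟨hcop, ?_⟩
  intro m hm γ v hqv
  obtain ⟨h1, h2⟩ := hrec m (hn.squarefree_of_dvd hm) (hg m hm) (d m hm).emb.toRatAlgHom γ v hqv
  refine ⟨?_, fun ℓ hℓ hle ↦ ?_⟩
  · rw [hy m hm]
    exact h1
  · have hm' : m / ℓ ∣ n := (Nat.div_dvd_of_dvd (Nat.dvd_of_mem_primeFactors hℓ)).trans hm
    rw [hy (m / ℓ) hm']
    exact h2 (m / ℓ) (hn.squarefree_of_dvd hm') (hg (m / ℓ) hm') hle

/-! ### §4 The two single-datum producers from the E′-labels at the carriers -/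

set_option maxHeartbeats 800000 in
/-- **The producer `hSel`** (Gross 6.2 (1): `c_M(d) ∈ Sel_𝔳` at every finite `𝔳 ∤ n`) for EVERY datum `d` with `d.y = ys n` on a Shimura
frame `(W, N, K, S)` carrying `LabelsAt`, the E′-LABELS AT THE CARRIER PRIMES OUTSIDE `S` (`hE0T`, per prime under `p ∣ c_q(E/ℚ_q)`),
the displayed Milne I.3.8 hypothesis `hM38`, `E[p]` irreducible, admissible `E(K[m])` — tam3-p1 g15's
`kolyvaginClass_familyData_mem_selmerLocalKer_of_labelsAt_of_tamagawa` with `hB6T` replaced by `hE0T` (one exponent for all carriers by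
§2, then the generic Kummer core `kolyvaginClass_familyData_mem_selmerLocalKer_of_tamagawa` with that `n'`).
[cite: GrossLMS1991, §6 Prop. 6.2 (1), p. 245] [cite: Jetchev2008, Prop. 4.6, Cor. 4.8] [cite: MilneADT2006, Ch. I Prop. 3.8] -/
theorem kolyvaginClass_familyData_mem_selmerLocalKer_of_labelsAt_of_tamagawa_of_E0Prime {N : ℕ} [NeZero N] [W.IsElliptic]
    [W.IsGloballyMinimal]
    (hK : IsImaginaryQuadratic K) (ι : K →+* ℂ) (hN : W.conductorNorm ℤ = N) {p : ℕ} [Fact p.Prime]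
    (Dt : ModularParametrizationData W N) [∀ j : ℕ, NumberField (ringClassField K ι j)]
    {S : Finset ℕ}
    (hin : ∀ ℓ ∈ S, ℓ.Prime ∧ ℓ ∣ N ∧ ¬ ℓ ^ 2 ∣ N ∧
      ((Ideal.span {(ℓ : ℤ)}).primesOver (𝓞 K)).ncard = 1 ∧ ¬ (ℓ : ℤ) ∣ NumberField.discr K)
    (hsp : ∀ ℓ : ℕ, ℓ.Prime → ℓ ∣ N → ℓ ∉ S → ((Ideal.span {(ℓ : ℤ)}).primesOver (𝓞 K)).ncard = 2)
    (ys : (m : ℕ) → (W.baseChange (ringClassField K ι m)).toAffine.Point)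
    {yK : (W.baseChange K).toAffine.Point} {ε : ℤ} (hL : LabelsAt W N K ι yK ys ε)
    (hE0T : ∀ (q : ℕ) [Fact q.Prime], q ∣ N → q ∉ S → p ∣ (W.baseChange ℚ_[q]).localTamagawaNumber ℤ_[q] →
      ∃ n' : ℕ, ¬ p ∣ n' ∧ ∀ m : ℕ, Squarefree m → (∀ r ∈ m.primeFactors, ¬ r ∣ N ∧ (Ideal.span {(r : 𝓞 K)}).IsPrime) →
        ∀ [NumberField (ringClassField K ι m)] (w : HeightOneSpectrum (𝓞 (ringClassField K ι m))),
          ((q : ℕ) : 𝓞 (ringClassField K ι m)) ∈ w.asIdeal →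
          (placeIntModel W (ringClassField K ι m) w).HasNonsingularReduction (K := ringClassField K ι m) (n' • ys m))
    (hM38 : ∀ (v : HeightOneSpectrum (𝓞 K)) {𝔐 : Ideal (v.localAbsIntegers)}, 𝔐 ∈ v.localPrimesAbove →
      ∀ f : contOneCocycles (discreteTopRep (absoluteGaloisGroup (v.adicCompletion K))
          (localPoints (W.baseChange K) (v.adicCompletion K))),
        (∀ σ ∈ 𝔐.inertia (absoluteGaloisGroup (v.adicCompletion K)), f.1 σ = 0) →
        (((W.baseChange K).baseChange (v.adicCompletion K)).localTamagawaNumber (v.adicCompletionIntegers K) : ℤ) •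
          oneCocycleClass (discreteTopRep (absoluteGaloisGroup (v.adicCompletion K))
            (localPoints (W.baseChange K) (v.adicCompletion K))) f = 0)
    (hA : ∀ (m : ℕ) (dm : KolyvaginFamilyData W K ι m), dm.y = ys m → Squarefree m →
      (∀ q ∈ m.primeFactors, IsKolyvaginPrime N W K p q) →
      ∀ j : ℕ, IsAdmissible (absoluteGaloisGroup K) dm.pointsSubgroup ((p ^ j : ℕ) : ℤ))
    (M n : ℕ) (d : KolyvaginFamilyData W K ι n) (hM : 1 ≤ M) (hdy : d.y = ys n) (hn : Squarefree n)
    (hKol : ∀ q ∈ n.primeFactors, IsKolyvaginPrime N W K p q ∧ FrobEqFrobInfty W K (p ^ M) q)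
    (𝔳 : HeightOneSpectrum (𝓞 K)) (h𝔳 : (n : 𝓞 K) ∉ 𝔳.asIdeal) :
    d.kolyvaginClass (Fact.out : p.Prime) M ∈ selmerLocalKer (W.baseChange K) (𝔳.adicCompletion K) ((p ^ M : ℕ) : ℤ) := by
  have hp : p.Prime := Fact.out
  have hn0 : n ≠ 0 := hn.ne_zero
  have hguard : ∀ q ∈ n.primeFactors, ¬ q ∣ N ∧ (Ideal.span {(q : 𝓞 K)}).IsPrime :=
    fun q hq ↦ ⟨(hKol q hq).1.2.1, (hKol q hq).1.2.2.2.2.1⟩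
  obtain ⟨D, hDd, hDy⟩ := exists_familyData_extension (W := W) hK ι hn (fun q hq ↦ (hguard q hq).2) ys d hdy
  subst hDd
  obtain ⟨hB4d, -, -⟩ := familyLabels_of_labelsAt (W := W) hn hguard ys hL D hDy
  -- ONE exponent for every carrier outside `S`
  obtain ⟨n', hpn', hE0⟩ := ShimuraKolyvaginOfImage.exists_uniform_exponent_of_carrierLabelsE0Prime W ι p S ys hE0T
  have hcop1 : IsCoprime (p : ℤ) (n' : ℤ) :=
    Nat.isCoprime_iff_coprime.mpr ((Nat.Prime.coprime_iff_not_dvd hp).mpr hpn')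
  have hcop : IsCoprime ((p ^ M : ℕ) : ℤ) (n' : ℤ) := by
    rw [Nat.cast_pow]; exact hcop1.pow_left
  have hA' : ∀ (m : ℕ) (hm : m ∣ n), IsAdmissible (absoluteGaloisGroup K) (D m hm).pointsSubgroup ((p ^ M : ℕ) : ℤ) :=
    fun m hm ↦ hA m (D m hm) (hDy m hm) (hn.squarefree_of_dvd hm)
      (fun q hq ↦ (hKol q (Nat.primeFactors_mono hm hn0 hq)).1) M
  have hrec : ∀ (q : ℕ), q.Prime → q ∣ N → q ∉ S → ∀ (m : ℕ) (hm : m ∣ n)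
      (γ : ringClassField K ι m ≃ₐ[ℚ] ringClassField K ι m) (v : HeightOneSpectrum (𝓞 K)),
      ((q : ℕ) : 𝓞 K) ∈ v.asIdeal →
      p ∣ ((W.baseChange K).baseChange (v.adicCompletion K)).localTamagawaNumber (v.adicCompletionIntegers K) →
        (n' : ℤ) • pointsMap (W.baseChange K) (v.adicCompletion K)
            ((D m hm).toGeomPoints (pointGalHom W (ringClassField K ι m) γ (D m hm).y)) ∈
          E0Receptacle (W.baseChange K) v ∧
        ∀ (ℓ : ℕ) (hℓ : ℓ ∈ m.primeFactors)
          (hle : ringClassField K ι (m / ℓ) ≤ ringClassField K ι m),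
          (n' : ℤ) • pointsMap (W.baseChange K) (v.adicCompletion K)
              ((D m hm).toGeomPoints (pointGalHom W (ringClassField K ι m) γ
                (WeierstrassCurve.Affine.Point.map (W' := W)
                  ((RingClassField.inclusion ι hle).restrictScalars ℚ)
                  (D (m / ℓ) ((Nat.div_dvd_of_dvd (Nat.dvd_of_mem_primeFactors hℓ)).trans hm)).y))) ∈
            E0Receptacle (W.baseChange K) v := by
    intro q hqp hqN hqS m hm γ v hqv hcv
    haveI : Fact q.Prime := ⟨hqp⟩
    have hq2 := hsp q hqp hqN hqS
    have hcq : p ∣ (W.baseChange ℚ_[q]).localTamagawaNumber ℤ_[q] :=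
      dvd_localTamagawaNumber_padic_of_dvd_of_ncard_eq_two (W := W) hK q hq2 hqN v hqv hcv
    exact (familyReceptacle_of_labelE0Prime (W := W) hK ι p hn hguard ys hqp hqN hq2 hpn'
      (fun m hm hg w hw ↦ hE0 q hqN hqS hcq m hm hg w hw) D hDy).2 m hm γ v hqv
  exact kolyvaginClass_familyData_mem_selmerLocalKer_of_tamagawa hK ι hN hp hM Dt hM38 hin hn hKol D hB4d hcop hrec
    hA' n dvd_rfl 𝔳 h𝔳

set_option maxHeartbeats 800000 in
/-- **The producer `hstrq`** (Jetchev Prop. 4.9: `loc_v c_k(d) ∈ H¹_{𝓕⁰}(K_v)` at a bad place `v` over the exempted split prime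
`q ∉ S`, `q ∣ N`) for EVERY datum `d` with `d.y = ys n` on a Shimura frame carrying `LabelsAt` and the E′-LABEL at that prime
(exponent `n'` prime to `p`), admissible `E(K[m])` — tam3-p1 g15's `…_of_labelB6_singleton` with the singleton (B6) replaced by
the E′-label (§3 + the generic core `localization_kolyvaginClass_familyData_mem_stringentFamily` with that `n'`).
[cite: Jetchev2008, Prop. 4.9, Cor. 4.8] [cite: GrossLMS1991, §6, proof of Prop. 6.2 (1), p. 245] -/
theorem localization_kolyvaginClass_familyData_mem_stringentFamily_of_labelE0Prime_singleton {N : ℕ} [NeZero N]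
    [W.IsElliptic] [W.IsGloballyMinimal]
    (hK : IsImaginaryQuadratic K) (ι : K →+* ℂ) {p : ℕ} [Fact p.Prime]
    (Dt : ModularParametrizationData W N) [∀ j : ℕ, NumberField (ringClassField K ι j)]
    {S : Finset ℕ}
    (hsp : ∀ ℓ : ℕ, ℓ.Prime → ℓ ∣ N → ℓ ∉ S → ((Ideal.span {(ℓ : ℤ)}).primesOver (𝓞 K)).ncard = 2)
    (ys : (m : ℕ) → (W.baseChange (ringClassField K ι m)).toAffine.Point)
    {yK : (W.baseChange K).toAffine.Point} {ε : ℤ} (hL : LabelsAt W N K ι yK ys ε)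
    (q : ℕ) [Fact q.Prime] (hqN : q ∣ N) (hqS : q ∉ S) {n' : ℕ} (hpn' : ¬ p ∣ n')
    (hE0q : ∀ m : ℕ, Squarefree m → (∀ r ∈ m.primeFactors, ¬ r ∣ N ∧ (Ideal.span {(r : 𝓞 K)}).IsPrime) →
      ∀ w : HeightOneSpectrum (𝓞 (ringClassField K ι m)), ((q : ℕ) : 𝓞 (ringClassField K ι m)) ∈ w.asIdeal →
        (placeIntModel W (ringClassField K ι m) w).HasNonsingularReduction (K := ringClassField K ι m) (n' • ys m))
    (hA : ∀ (m : ℕ) (dm : KolyvaginFamilyData W K ι m), dm.y = ys m → Squarefree m →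
      (∀ q ∈ m.primeFactors, IsKolyvaginPrime N W K p q) →
      ∀ j : ℕ, IsAdmissible (absoluteGaloisGroup K) dm.pointsSubgroup ((p ^ j : ℕ) : ℤ))
    (k : ℕ) (hn' : ((p ^ k : ℕ) : ℤ) ≠ 0) (n : ℕ) (d : KolyvaginFamilyData W K ι n) (hk : 1 ≤ k) (hdy : d.y = ys n)
    (hn : Squarefree n)
    (hKol : ∀ q' ∈ n.primeFactors, IsKolyvaginPrime N W K p q' ∧ FrobEqFrobInfty W K (p ^ k) q')
    (v : HeightOneSpectrum (𝓞 K)) (hqv : ((q : ℕ) : 𝓞 K) ∈ v.asIdeal) (hbad : ¬ (W.baseChange K).HasGoodReductionAt v) :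
    galoisCohomology.localization ((W.baseChange K).torsionGaloisModule ((p ^ k : ℕ) : ℤ)) (Sum.inr v) 1
        (d.kolyvaginClass (Fact.out : p.Prime) k) ∈ stringentFamily W K hn' (Sum.inr v) := by
  have hp : p.Prime := Fact.out
  have hq : q.Prime := Fact.out
  have hn0 : n ≠ 0 := hn.ne_zero
  have hguard : ∀ q' ∈ n.primeFactors, ¬ q' ∣ N ∧ (Ideal.span {(q' : 𝓞 K)}).IsPrime :=
    fun q' hq' ↦ ⟨(hKol q' hq').1.2.1, (hKol q' hq').1.2.2.2.2.1⟩
  -- `v ∌ n`: the primes of `n` are prime to `N`, `q ∣ N`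
  have hnv : (n : 𝓞 K) ∉ v.asIdeal :=
    natCast_not_mem_asIdeal_of_prime_mem v hq hqv hn0 fun ℓ hℓ hℓq ↦ (hguard ℓ hℓ).1 (hℓq ▸ hqN)
  obtain ⟨D, hDd, hDy⟩ := exists_familyData_extension (W := W) hK ι hn (fun q' hq' ↦ (hguard q' hq').2) ys d hdy
  subst hDd
  obtain ⟨hB4d, -, -⟩ := familyLabels_of_labelsAt (W := W) hn hguard ys hL D hDy
  have hq2 := hsp q hq hqN hqS
  obtain ⟨hcop1, hrecQ⟩ := familyReceptacle_of_labelE0Prime (W := W) hK ι p hn hguard ys hq hqN hq2 hpn' hE0q D hDy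
  have hcop : IsCoprime ((p ^ k : ℕ) : ℤ) (n' : ℤ) := by
    rw [Nat.cast_pow]; exact hcop1.pow_left
  have hA' : ∀ (m : ℕ) (hm : m ∣ n), IsAdmissible (absoluteGaloisGroup K) (D m hm).pointsSubgroup ((p ^ k : ℕ) : ℤ) :=
    fun m hm ↦ hA m (D m hm) (hDy m hm) (hn.squarefree_of_dvd hm)
      (fun q' hq' ↦ (hKol q' (Nat.primeFactors_mono hm hn0 hq')).1) k
  exact localization_kolyvaginClass_familyData_mem_stringentFamily hK ι hp hk hn' Dt hn hKol D hB4d hA' dvd_rfl q hqN hq2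
    v hqv hnv hbad hcop (fun γ ↦ hrecQ n dvd_rfl γ v hqv)

end Summit.BirchSwinnertonDyer.BirchSwinnertonDyer.Theorems.ShimuraWalk

end
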